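/-
Copyright (c) 2026 the pub-hodgecm-mathlib formalisation cell (harness21).  Prover seat hodgecm-mathlib-K2-defs1 (g6), Track B, h413 = `stmt-HodgeConjecture-24833`, route `HCCMUnconditional`,
campaign «5Res (b) BL-2(χ,τ)», SHEET row 12c (dealer K2E1-plan (g6) ruling (119) 2026-09-04T11:06:07Z: «12c on the letter `𝔥_h z = s z • 1`; the arch computation in 12d»).
-/
import Summits.HodgeConjecture.HodgeConjecture.Theorems.K2E1ChiEisensteinUniquenessU2   -- ★ p859627 (this seat) row 12a: `forall_not_hasEigenvalue_smul_one_iff`; brings ★ P6′ §1.3 (`isOpen_uniqueSetSA`, `uniqueSetSA_nonempty[_two]`, `exists_mem_im_ne_zero_of_differentiable`)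
import HarnessLib

/-!
# 5Res (b) row 12c — `K2E1ChiHeckeMatrixSeparationU2`: THE SEPARATION LETTER `hsep` («the Hecke matrix has no real eigenvalue on a non-empty open `U₀ ⊆ ball ∩ {σ₀ < Re}`») FROM A SCALAR HECKE
# MATRIX `𝔥(z) = s(z)·1` — in particular for `s = ĥ`, the spherical transform of a non-negative test function (EXACTLY the ★ P6′ §1.3 device), rank-generic

Cell `pub/hodgecm-mathlib`, crux H413 = `stmt-HodgeConjecture-24833`.  THEOREMS ONLY (no `def`, no `instance`, no notation, no named-fact hypothesis, no `sorry`); lane `--supports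
stmt-HodgeConjecture-24833 --as helper` (count-neutral).  Closes no socket.

THE MATHEMATICS ([BernsteinLapid2019, §4 Claim 1, Thm 2.3]; [Langlands1976, §6]).  Row 12a (★ `homogeneous_eq_zero_of_memLp_on`) needs `hsep : ∀ z ∈ U₀, ∀ r : ℝ, ¬ HasEigenvalue (𝔥 z) r` on a
non-empty open `U₀`.  When the chosen symmetric real test function acts on the section space `V` by a SCALAR — `𝔥(z) = s(z)·1_V` with `s` entire and non-constant (the road of record (119): an
ARCHIMEDEAN-ONLY test function `h = h_∞ ⊗ 𝟙`, for which `B_∞K_∞ = G_∞` forces every `φ ∈ V(χ,K′,ω)` to share its archimedean factor, so `R(h)` acts by `ĥ_∞(z, χ_∞, τ)`; the arch computation is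
row 12d) — «no real eigenvalue» is «`Im s(z) ≠ 0`» (★ row 12a `forall_not_hasEigenvalue_smul_one_iff`), and an entire non-constant `s` takes non-real values on an open subset of every non-empty open
set (★ P6′ `exists_mem_im_ne_zero_of_differentiable`, Mathlib open mapping).  §2 is the instance `s = ĥ(z) = ∫ h(x)H(x)^z dμ_G` for `h ≥ 0` continuous of compact support not vanishing at a point of
height `> 1` (★ P6′ `uniqueSetSA_nonempty`; at `N = 2` from `h(1) ≠ 0`, ★ `uniqueSetSA_nonempty_two`) — the spherical `hsep` VERBATIM, now typed against the matrix letter.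
* §1 `forall_not_hasEigenvalue_of_eq_smul_one`, **`exists_isOpen_forall_not_hasEigenvalue_of_eq_smul`** (`s` entire non-constant ⟹ `hsep` inside any non-empty open `W`).
* §2 **`exists_isOpen_forall_not_hasEigenvalue_of_eq_integral_smul`** (`s = ĥ`, `h ≥ 0`, `h(g₀) ≠ 0`, `H(g₀) > 1`; `U₀ ⊆ ball 0 (n+2) ∩ {1 < Re}`), **`…_two`** (`N = 2`, from `h(1) ≠ 0`).
HONEST LABEL: HC_CM is proved only modulo the 7 printed citations (2 remaining named inputs: hLiu418 = `stmt-HodgeConjecture-24832`, h413 = `stmt-HodgeConjecture-24833`) until rung 0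
closes; count-neutral helper, closes no socket.  The letter «`𝔥_h(z) = s(z)·1`» for an archimedean-only `h` (row 12d) is NOT proved here.

## References
* [BernsteinLapid2019] J. Bernstein, E. Lapid, *On the meromorphic continuation of Eisenstein series*, J. Amer. Math. Soc. 37 (2024) (arXiv:1911.02342), §4 Claim 1, Thm 2.3.
* [Langlands1976] R. P. Langlands, *On the Functional Equations Satisfied by Eisenstein Series*, LNM 544 (1976), §6 p. 167.
-/

set_option autoImplicit false
-- the mandated namespace repeats the single-problem summit's segment (`HodgeConjecture.HodgeConjecture`)
set_option linter.dupNamespace false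

noncomputable section

open MeasureTheory MeasureTheory.Measure Set NumberField IsDedekindDomain Filter Topology Metric
open scoped NNReal ENNReal ComplexConjugate
open Literature.NumberTheory.Automorphic Literature.NumberTheory.Automorphic.UnitaryGroup AdelicGroupData
open Summit.HodgeConjecture.HodgeConjecture.Cruxes.H413.K2E1ChiEisensteinUniquenessU2 (forall_not_hasEigenvalue_smul_one_iff)
open Summit.HodgeConjecture.HodgeConjecture.Cruxes.H413.K2E1BLUniquenessSelfAdjointU2 (exists_mem_im_ne_zero_of_differentiable isOpen_uniqueSetSA uniqueSetSA_nonempty uniqueSetSA_nonempty_two)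

namespace Summit.HodgeConjecture.HodgeConjecture.Cruxes.H413.K2E1ChiHeckeMatrixSeparationU2

/-! ## §1 `hsep` from a scalar Hecke matrix `𝔥(z) = s(z)·1` with `s` entire and non-constant -/

section Scalar

variable {V : Type*} [AddCommGroup V] [Module ℂ V] [Nontrivial V]

/-- A scalar endomorphism `a·1` with `Im a ≠ 0` has no real eigenvalue (★ row 12a, one direction). [cite: BernsteinLapid2019, §4 Claim 2 (p. 9)] -/
theorem forall_not_hasEigenvalue_of_eq_smul_one {𝔥 : Module.End ℂ V} {a : ℂ} (h𝔥 : 𝔥 = a • (1 : Module.End ℂ V)) (ha : a.im ≠ 0) :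
    ∀ r : ℝ, ¬ 𝔥.HasEigenvalue (r : ℂ) := by
  rw [h𝔥]
  exact (forall_not_hasEigenvalue_smul_one_iff a).2 ha

/-- **`hsep` FROM A SCALAR HECKE MATRIX**: if `𝔥(z) = s(z)·1_V` with `s` entire and non-constant, then inside every non-empty open `W ⊆ ℂ` there is a non-empty open `U₀` on which `𝔥(z)` has no real
eigenvalue — `U₀ = W ∩ {Im s ≠ 0}` (★ `exists_mem_im_ne_zero_of_differentiable`: open mapping). [cite: BernsteinLapid2019, §4 Claim 1, Thm 2.3] [cite: Langlands1976, §6 p. 167] -/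
theorem exists_isOpen_forall_not_hasEigenvalue_of_eq_smul (𝔥 : ℂ → Module.End ℂ V) (s : ℂ → ℂ) (h𝔥 : ∀ z, 𝔥 z = s z • (1 : Module.End ℂ V))
    (hs : Differentiable ℂ s) (hnc : ¬ ∃ w : ℂ, ∀ z, s z = w) {W : Set ℂ} (hW : IsOpen W) (hWne : W.Nonempty) :
    ∃ U₀ : Set ℂ, IsOpen U₀ ∧ U₀.Nonempty ∧ U₀ ⊆ W ∧ ∀ z ∈ U₀, ∀ r : ℝ, ¬ (𝔥 z).HasEigenvalue (r : ℂ) := by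
  obtain ⟨z₀, hz₀, hz₀im⟩ := exists_mem_im_ne_zero_of_differentiable hs hnc hW hWne
  refine ⟨W ∩ {z : ℂ | (s z).im ≠ 0}, hW.inter (isOpen_ne_fun (Complex.continuous_im.comp hs.continuous) continuous_const), ⟨z₀, hz₀, hz₀im⟩, inter_subset_left, ?_⟩
  rintro z ⟨-, hz⟩
  exact forall_not_hasEigenvalue_of_eq_smul_one (h𝔥 z) hz

end Scalar

/-! ## §2 The instance `s = ĥ`: the spherical transform of a non-negative test function -/

section Transform

variable {F E : Type} [Field F] [NumberField F] [Field E] [NumberField E] [Algebra F E] {c : E ≃ₐ[F] E} {N : ℕ} [NeZero N]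
variable [MeasurableSpace (quasiSplit F E c N).Adelic] [BorelSpace (quasiSplit F E c N).Adelic]
variable {V : Type*} [AddCommGroup V] [Module ℂ V] [Nontrivial V]

/-- **`hsep` FOR A HECKE MATRIX ACTING BY THE TRANSFORM `ĥ(z) = ∫ h(x)H(x)^z dμ_G`** of a test function `h ≥ 0`, continuous of compact support, with `h(g₀) ≠ 0` at a point of height `> 1`:
`U₀ := ball 0 (n+2) ∩ {1 < Re z} ∩ {Im ĥ(z) ≠ 0}` is open (★ `isOpen_uniqueSetSA`), non-empty (★ `uniqueSetSA_nonempty`: `ĥ` entire, `→ +∞` along the reals), and on it `𝔥(z) = ĥ(z)·1` has no real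
eigenvalue — the bytes of ★ row 12a's letter `hsep` with `U₀ ⊆ ball 0 (n+2) ∩ {1 < Re}`. [cite: BernsteinLapid2019, §4 Claim 1, Thm 2.3] [cite: Langlands1976, §6 p. 167] -/
theorem exists_isOpen_forall_not_hasEigenvalue_of_eq_integral_smul (μG : Measure (quasiSplit F E c N).Adelic) [IsFiniteMeasureOnCompacts μG] [μG.IsOpenPosMeasure]
    {h : (quasiSplit F E c N).Adelic → ℝ} (hh : Continuous h) (hhs : HasCompactSupport h) (h0 : ∀ x, 0 ≤ h x)
    {g₀ : (quasiSplit F E c N).Adelic} (hg₀ : h g₀ ≠ 0) (hH : 1 < borelHeight g₀) (n : ℕ)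
    (𝔥 : ℂ → Module.End ℂ V) (h𝔥 : ∀ z, 𝔥 z = (∫ x, (h x : ℂ) * (((borelHeight x : ℝ≥0) : ℝ) : ℂ) ^ z ∂μG) • (1 : Module.End ℂ V)) :
    ∃ U₀ : Set ℂ, IsOpen U₀ ∧ U₀.Nonempty ∧ U₀ ⊆ ball (0 : ℂ) (n + 2) ∩ {z : ℂ | 1 < z.re} ∧ ∀ z ∈ U₀, ∀ r : ℝ, ¬ (𝔥 z).HasEigenvalue (r : ℂ) := by
  have hhc : Continuous fun x => (h x : ℂ) := Complex.continuous_ofReal.comp hh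
  have hhsc : HasCompactSupport fun x => (h x : ℂ) := hhs.comp_left Complex.ofReal_zero
  refine ⟨ball (0 : ℂ) (n + 2) ∩ {z : ℂ | 1 < z.re} ∩ {z : ℂ | (∫ x, (h x : ℂ) * (((borelHeight x : ℝ≥0) : ℝ) : ℂ) ^ z ∂μG).im ≠ 0},
    isOpen_uniqueSetSA μG hhc hhsc n, uniqueSetSA_nonempty μG hh hhs h0 hg₀ hH n, inter_subset_left, ?_⟩
  rintro z ⟨-, hz⟩
  exact forall_not_hasEigenvalue_of_eq_smul_one (h𝔥 z) hz

/-- **`hsep` AT `N = 2` FROM `h(1) ≠ 0`** (`c² = 1`; the point of height `> 1` is supplied by ★ `uniqueSetSA_nonempty_two`) — the shape the (χ,τ) ball (row 12b) consumes for the symmetric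
test functions `h = η^∨ ∗ η` (`h ≥ 0`, `h(1) = ‖η‖₂² > 0`) once row 12d shows that an archimedean-only such `h` acts on `V(χ, K′, ω)` by `ĥ(z)·1`. [cite: BernsteinLapid2019, §4 Claim 1, Thm 2.3] -/
theorem exists_isOpen_forall_not_hasEigenvalue_of_eq_integral_smul_two {F E : Type} [Field F] [NumberField F] [Field E] [NumberField E] [Algebra F E] {c : E ≃ₐ[F] E} (hc : c * c = 1)
    [MeasurableSpace (quasiSplit F E c 2).Adelic] [BorelSpace (quasiSplit F E c 2).Adelic]
    (μG : Measure (quasiSplit F E c 2).Adelic) [IsFiniteMeasureOnCompacts μG] [μG.IsOpenPosMeasure]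
    {h : (quasiSplit F E c 2).Adelic → ℝ} (hh : Continuous h) (hhs : HasCompactSupport h) (h0 : ∀ x, 0 ≤ h x) (hh1 : h 1 ≠ 0) (n : ℕ)
    {V : Type*} [AddCommGroup V] [Module ℂ V] [Nontrivial V]
    (𝔥 : ℂ → Module.End ℂ V) (h𝔥 : ∀ z, 𝔥 z = (∫ x, (h x : ℂ) * (((borelHeight x : ℝ≥0) : ℝ) : ℂ) ^ z ∂μG) • (1 : Module.End ℂ V)) :
    ∃ U₀ : Set ℂ, IsOpen U₀ ∧ U₀.Nonempty ∧ U₀ ⊆ ball (0 : ℂ) (n + 2) ∩ {z : ℂ | 1 < z.re} ∧ ∀ z ∈ U₀, ∀ r : ℝ, ¬ (𝔥 z).HasEigenvalue (r : ℂ) := by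
  have hhc : Continuous fun x => (h x : ℂ) := Complex.continuous_ofReal.comp hh
  have hhsc : HasCompactSupport fun x => (h x : ℂ) := hhs.comp_left Complex.ofReal_zero
  refine ⟨ball (0 : ℂ) (n + 2) ∩ {z : ℂ | 1 < z.re} ∩ {z : ℂ | (∫ x, (h x : ℂ) * (((borelHeight x : ℝ≥0) : ℝ) : ℂ) ^ z ∂μG).im ≠ 0},
    isOpen_uniqueSetSA μG hhc hhsc n, uniqueSetSA_nonempty_two hc μG hh hhs h0 hh1 n, inter_subset_left, ?_⟩
  rintro z ⟨-, hz⟩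
  exact forall_not_hasEigenvalue_of_eq_smul_one (h𝔥 z) hz

end Transform

end Summit.HodgeConjecture.HodgeConjecture.Cruxes.H413.K2E1ChiHeckeMatrixSeparationU2
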